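import Summits.CriticalPhenomena.PercolationContinuityZ3.Theorems.PercNearOneGluingNoHeavyLowerTailDualBHKConditional
import Summits.CriticalPhenomena.PercolationContinuityZ3.Theorems.PercNearOneGluingNoHeavyLowerTailRefinedRowR1WallTransport
import Mathlib.Tactic.Linarith
import HarnessLib

/-!
# `NoHeavyLowerTail` (stmt-CriticalPhenomena-4575) — THEOREM R1 of the separating-cluster refinement,
# `t · s_a ≤ u_b · u_c`, IS the tree's dual BHK inequality: the bridge

Support file (prover prim-gen-kcluster gen 38; `--supports stmt-CriticalPhenomena-4575`).  No named facts, no sorries, no definitions.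

The refined quadratic row R1 of KCLUSTER-gen32 §4 (run/shared/lean/prim/prim-gen-kcluster/), `u_b · u_c ≥ t · s_a` — with the apex
cells of `…RefinedRowR3Switching` / `…RefinedRowR2FourFunctions`: `t = PrW(cellT a b c)` (`b, c ∈ cl X a`), `u_c = PrW(cellUc a b c)`
(`b ∈ cl X a`, `c ∉ cl X a`), `u_b = PrW(cellUc a c b)`, `s_a = PrW(cellSa D a b c)` (pairwise apart and `cl X a` meets every `b–c` path of the
support `D`) — was carried as an open census row by this unit (gens 32–37; paper proof THEOREM-R1.md, gen 37).  It is, verbatim, the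
**dual BHK inequality** `t · n′ ≤ u₁ · u₂` PROVED IN THE TREE by prover prim-ineq-gen-2 (gen 6, 2026-08-20): `DualBHK.dualBHK`
(`…DualBHK.lean`; families `DualBHK.ea_univ` / `DualBHK.master_univ`, an Ahlswede–Daykin vertex-peeling induction; memo
run/shared/lean/prim/prim-ineq-gen-2/DUAL-BHK.md §8), stated there in the lane vocabulary `CubicThreePointStep.evT/evU₁/evU₂`,
`CubicThreePointApex.evNp` with forced edges `K`.  This file is the dictionary at `K = ∅` and the one-line transfer:
* `R_empty_iff` — lane reachability with no forced edge is membership in the Gladkov cluster: `R ∅ S x y ↔ y ∈ cl S x`;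
* `apexSep_iff` — the two support-separation predicates agree: `CubicThreePointApex.Sep D ∅ S a b c ↔ RefinedRowR3.Sep D (cl S a) b c`;
* `evT_empty_eq`, `evU₁_empty_eq`, `evU₂_empty_eq`, `evNp_empty_eq` — the four cells coincide as sets of configurations;
* **`r1_PrW`** — THEOREM R1: `PrW(cellT) · PrW(cellSa) ≤ PrW(cellUc a b c) · PrW(cellUc a c b)` on every finite weighted graph, and the slack
  form `r1_PrW'`.  With `RefinedRowR2.r2_PrW` and `RefinedRowR3.r3_PrW` all three refined rows R1–R3 of KCLUSTER-gen32 are now tree theorems.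
The Harris-ratio / conditional forms of R1 (KCLUSTER-gen33 §1: `P(a~b)P(a~c) ≥ P(a~b~c)·P(C_a meets every b–c path)`; negative correlation of
`{a~b}`, `{a~c}` given the separation) are `DualBHKSep.t_mul_sep_le`, `DualBHKSep.condNegCorr_sep`, `DualBHKSep.cov_ab_ac_le` (prim-ineq-gen-2 gen 7).
Dictionary of the by-products of THEOREM-R1.md: the hub inequality (SPLIT)(H;a,c;S) is the instance `EA(S;{c},{c},{c})` of `DualBHK.ea_univ`,
the family `𝓐(H;S,T;W)` is `MASTER(S,T,W;{c},{c},{c})` of `DualBHK.master_univ`, and (HR1)(S) is `MASTER(S,∅,S;{c},{c},{c})`.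
[this work; the inequality is prim-ineq-gen-2's `DualBHK.dualBHK`]
-/

noncomputable section

namespace Summit.CriticalPhenomena.PercolationContinuityZ3.Theorems

namespace RefinedRowR1

open Finset Literature.Probability.Percolation Literature.Probability.Percolation.DecisionTree
open Literature.Probability.Percolation.Gladkov ThreePointLB RefinedRowR3 RefinedRowR2
open scoped Classical

variable {V : Type*} [Fintype V] [DecidableEq V]

/-! ### The dictionary at `K = ∅` -/

/-- Lane reachability with no forced edges is membership in the Gladkov cluster: `R ∅ S x y ↔ y ∈ cl S x`. [folklore] -/
theorem R_empty_iff {S : Finset (Sym2 V)} {x y : V} : CubicThreePointStep.R ∅ S x y ↔ y ∈ cl S x := by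
  rw [mem_cl]
  unfold CubicThreePointStep.R openGraph
  rw [Finset.union_empty]

/-- The two support-separation predicates agree: every `b–c` path of the support `D` meets the open cluster of `a`
(`CubicThreePointApex.Sep`, edges of `D` with both ends off the cluster) iff `c ∉ cl (D ∖ touch (cl S a)) b` (`RefinedRowR3.Sep`). [folklore] -/
theorem apexSep_iff {D S : Finset (Sym2 V)} {a b c : V} :
    CubicThreePointApex.Sep D ∅ S a b c ↔ Sep D (cl S a) b c := by
  have hE : {f : Sym2 V | f ∈ D ∧ ∀ z, z ∈ f → ¬ CubicThreePointStep.R ∅ S a z} =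
      (↑(D \ touch (cl S a)) : Set (Sym2 V)) := by
    ext f
    rw [Set.mem_setOf_eq, Finset.mem_coe, Finset.mem_sdiff, mem_touch]
    constructor
    · rintro ⟨hfD, hf⟩
      refine ⟨hfD, ?_⟩
      rintro ⟨v, hv, hvf⟩
      exact hf v hvf (R_empty_iff.2 hv)
    · rintro ⟨hfD, hf⟩
      exact ⟨hfD, fun z hz hR => hf ⟨z, R_empty_iff.1 hR, hz⟩⟩
  unfold CubicThreePointApex.Sep RefinedRowR3.Sep
  rw [hE, mem_cl]
  rfl

/-- `t`: the lane cell `abc` with no forced edge is `cellT`. [folklore] -/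
theorem evT_empty_eq (a b c : V) : CubicThreePointStep.evT (∅ : Finset (Sym2 V)) a b c = cellT a b c := by
  ext S
  rw [CubicThreePointStep.mem_evT, mem_cellT, R_empty_iff, R_empty_iff]

/-- `u_c`: the lane cell `ab|c` with no forced edge is `cellUc a b c`. [folklore] -/
theorem evU₁_empty_eq (a b c : V) : CubicThreePointStep.evU₁ (∅ : Finset (Sym2 V)) a b c = cellUc a b c := by
  ext S
  rw [CubicThreePointStep.mem_evU₁, mem_cellUc, R_empty_iff, R_empty_iff]

/-- `u_b`: the lane cell `ac|b` with no forced edge is `cellUc a c b`. [folklore] -/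
theorem evU₂_empty_eq (a b c : V) : CubicThreePointStep.evU₂ (∅ : Finset (Sym2 V)) a b c = cellUc a c b := by
  ext S
  rw [CubicThreePointStep.mem_evU₂, mem_cellUc, R_empty_iff, R_empty_iff]

/-- `s_a`: the apex-refined lane cell `N′` (pairwise apart, the cluster of `a` separating `b` from `c` in the support) with no forced
edge is `cellSa`. [folklore] -/
theorem evNp_empty_eq (D : Finset (Sym2 V)) (a b c : V) :
    CubicThreePointApex.evNp (D ∪ ∅) (∅ : Finset (Sym2 V)) a b c = cellSa D a b c := by
  ext S
  rw [Finset.union_empty, CubicThreePointApex.mem_evNp, mem_cellSa, mem_apart, R_empty_iff, R_empty_iff, R_empty_iff,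
    apexSep_iff]

/-! ### THEOREM R1 -/

section Measure

variable (D : Finset (Sym2 V)) {p : Sym2 V → ℝ} (hp0 : ∀ e, 0 ≤ p e) (hp1 : ∀ e, p e ≤ 1) (a b c : V)
include hp0 hp1

/-- **THEOREM R1** (`t · s_a ≤ u_c · u_b` on every finite weighted graph): `PrW(cellT) · PrW(cellSa) ≤ PrW(cellUc a b c) · PrW(cellUc a c b)` —
prim-ineq-gen-2's dual BHK inequality `DualBHK.dualBHK` read through the `K = ∅` dictionary. [this work; = `DualBHK.dualBHK`] -/
theorem r1_PrW :
    PrW D p (cellT a b c) * PrW D p (cellSa D a b c) ≤ PrW D p (cellUc a b c) * PrW D p (cellUc a c b) := by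
  have h := DualBHK.dualBHK hp0 hp1 D ∅ a b c
  rwa [evT_empty_eq, evNp_empty_eq, evU₁_empty_eq, evU₂_empty_eq] at h

/-- THEOREM R1 in slack form: `0 ≤ u_b u_c − t s_a`. [this work; = `DualBHK.dualBHK'`] -/
theorem r1_PrW' :
    0 ≤ PrW D p (cellUc a c b) * PrW D p (cellUc a b c) - PrW D p (cellT a b c) * PrW D p (cellSa D a b c) := by
  have h := r1_PrW D hp0 hp1 a b c
  linarith [mul_comm (PrW D p (cellUc a b c)) (PrW D p (cellUc a c b))]

end Measure

end RefinedRowR1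

end Summit.CriticalPhenomena.PercolationContinuityZ3.Theorems

end
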